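import Summits.Ventures.LatticeQCDFlow.Scoring.SchwingerDysonPhi4GibbsMonomial
import Mathlib.MeasureTheory.Integral.Prod
import HarnessLib

/-!
# The independence Metropolis (flow) sampler is exact for lattice φ⁴ on `ℝ^Λ`, for every positive model density

HONEST FRAMING: exact (Metropolis-corrected) sampling algorithms for lattice gauge theory;
figures of merit are autocorrelation/cost numbers at stated couplings and volumes; no
continuum-physics claim.  (SCALAR calibration rung S0-A: not a gauge result.)

Venture `LatticeQCDFlow` (cell pub-lqcd), topic `Exactness`; FANOUT row 2 (`s0-phi4`: the FLOW arm
of the 2D φ⁴ calibration — real-NVP proposals with the independence-Metropolis accept/reject of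
Albergo–Kanwar–Shanahan 2019).  NEW WORK of the cell (one Fubini swap on `X × X`, over Mathlib);
nothing is cited as a fact.  Printed counterparts, named only: Hastings 1970, Tierney 1994/1998
(independence Metropolis–Hastings), Albergo–Kanwar–Shanahan 2019 §II.C (flow-based MCMC is exact
for any model with the right support).

Relation to the tree.  `Exactness/FlowMCMC.lean` (row 30) proves the statement on FINITE spaces
(E1 of the venture statement); `Exactness/IMHKernel.lean` (row 30) types the independence sampler
as a Mathlib `Kernel` on a general space and proves reversibility abstractly.  This file is the
CONCRETE statement for row 2's flow sampler: target = interacting lattice φ⁴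
(`latticePhi4Action`, `λ > 0`, any real `J`) on `Fin (n+1) → ℝ` with Lebesgue measure, model = ANY
positive probability density `q` (a normalizing flow with positive prior density and exact
Jacobian), in the integrated form `∫ (K f) e^{−S} = ∫ f e^{−S}` over bounded measurable
observables, all side conditions discharged.

## What is proved

* §1 (general measure space `(X, μ)`, `μ` s-finite).  `imhFlow w q t t' = min(w t q t', w t' q t)`
  (symmetric, `imhFlow_symm`); `imh_accept_mul_weight` — detailed balance in density form
  `min(1, (w t' q t)/(w t q t')) q t' w t = imhFlow`; **`imh_integral_invariant`** — for a
  positive integrable weight `w`, a positive density `q` with `∫ q dμ = 1` and every bounded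
  measurable `g`: `∫ (K g) w dμ = ∫ g w dμ`,
  `(K g)(t) = ∫ [α g(t') + (1−α) g(t)] q(t') dμ(t')`, `α = min(1, (w t' q t)/(w t q t'))`
  (dominated by `w(t) q(t')`, Fubini, symmetry of the flow; the rejected mass stays put).
* §2 (the lattice).  `imhAcceptPhi4 J λ q φ φ' = min(1, e^{−S(φ')} q(φ) / (e^{−S(φ)} q(φ')))` — the
  importance-ratio test `min(1, w(φ')/w(φ))`, `w = p/q`; `imhOpPhi4` — the sampler's one-step
  operator; **`imh_exact`** — coercive action, positive measurable probability density `q`,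
  bounded measurable `f`: `∫ (K f) e^{−S} dφ = ∫ f e^{−S} dφ`; `imh_exact_expect` (`⟨K f⟩ = ⟨f⟩`);
  **`imh_exact_phi4`** — EVERY `λ > 0`, EVERY real `J` (the AKS 2019 sets `m² = −4` included), EVERY
  positive model density: the Metropolis-corrected flow sampler leaves the φ⁴ Gibbs law invariant —
  the model only moves the acceptance / ESS (`Scoring/FreeFieldFlowESS.lean` for the free-field
  numbers), never the sampled law.

With `Exactness/Phi4LocalMetropolisExact.lean` (local Metropolis) and `Exactness/SweepExact.lean`
(sweeps), and the HMC skeleton of rows 9/30 (`SplittingIntegrator` + `InvolutiveMetropolis`), all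
three sampler families of the S0-A calibration are typed as exact for the law they sample.
NOT CLAIMED: irreducibility / geometric ergodicity (needs `sup p/q < ∞`, cf. `IMHKernel.lean`,
`Scoring/FreeFieldFlowESS.gaussian_weight_le`), the construction of `q` for a concrete network.
-/

namespace Summit.Ventures.LatticeQCDFlow.Exactness

open Real MeasureTheory Finset Filter
open Summit.Ventures.LatticeQCDFlow.Scoring

/-! ## Independence Metropolis–Hastings on a general measure space, integrated form -/

section General

variable {X : Type*} [MeasurableSpace X] {μ : Measure X} [SFinite μ]

/-- The symmetrised flow of the independence sampler: `s(t, t') = min(w t · q t', w t' · q t)`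
(target weight `w`, proposal density `q`). -/
noncomputable def imhFlow (w q : X → ℝ) (t t' : X) : ℝ := min (w t * q t') (w t' * q t)

omit [MeasurableSpace X] in
/-- The flow is symmetric. -/
theorem imhFlow_symm (w q : X → ℝ) (t t' : X) : imhFlow w q t t' = imhFlow w q t' t := by
  unfold imhFlow; rw [min_comm]

omit [MeasurableSpace X] in
/-- Detailed balance in density form: `min(1, (w t' q t)/(w t q t')) · q t' · w t = s(t, t')`. -/
theorem imh_accept_mul_weight (w q : X → ℝ) {t t' : X} (hw : 0 < w t) (hq : 0 < q t') :
    min 1 (w t' * q t / (w t * q t')) * q t' * w t = imhFlow w q t t' := by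
  unfold imhFlow
  have hpos : 0 < q t' * w t := mul_pos hq hw
  rw [mul_assoc, min_mul_of_nonneg _ _ hpos.le, one_mul, mul_comm (q t') (w t),
    div_mul_cancel₀ _ (mul_pos hw hq).ne']

/-- **Independence Metropolis–Hastings preserves `w · μ`.**  For a positive integrable weight `w`,
a positive proposal density `q` with `∫ q dμ = 1`, and every bounded measurable `g`:
`∫ (K g) w dμ = ∫ g w dμ`, where
`(K g)(t) = ∫ [α g(t') + (1 − α) g(t)] q(t') dμ(t')`, `α = min(1, (w t' q t)/(w t q t'))` —
propose from `q`, accept with the importance-ratio test, else stay. -/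
theorem imh_integral_invariant {w q g : X → ℝ} (hw0 : ∀ t, 0 < w t) (hwm : Measurable w)
    (hwi : Integrable w μ) (hq0 : ∀ t, 0 < q t) (hqm : Measurable q) (hqi : Integrable q μ)
    (hq1 : ∫ t, q t ∂μ = 1) (hgm : Measurable g) {B : ℝ} (hgb : ∀ t, |g t| ≤ B) :
    ∫ t, (∫ t', (min 1 (w t' * q t / (w t * q t')) * g t'
        + (1 - min 1 (w t' * q t / (w t * q t'))) * g t) * q t' ∂μ) * w t ∂μ
      = ∫ t, g t * w t ∂μ := by
  have ha_le : ∀ t t', min (1 : ℝ) (w t' * q t / (w t * q t')) ≤ 1 := fun t t' => min_le_left _ _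
  have ha_nn : ∀ t t', 0 ≤ min (1 : ℝ) (w t' * q t / (w t * q t')) := fun t t' =>
    le_min zero_le_one (div_nonneg (mul_pos (hw0 t') (hq0 t)).le (mul_pos (hw0 t) (hq0 t')).le)
  -- the dominating function `w t · q t'` on the product
  have hGm : Measurable fun p : X × X => w p.1 * q p.2 :=
    (hwm.comp measurable_fst).mul (hqm.comp measurable_snd)
  have hG : Integrable (fun p : X × X => w p.1 * q p.2) (μ.prod μ) := by
    rw [integrable_prod_iff hGm.aestronglyMeasurable]
    constructor
    · exact Eventually.of_forall fun t => hqi.const_mul (w t)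
    · have e : (fun t => ∫ t', ‖w t * q t'‖ ∂μ) = fun t => w t := by
        funext t
        have h1 : ∀ t', ‖w t * q t'‖ = w t * q t' := fun t' => by
          rw [Real.norm_eq_abs, abs_of_nonneg (mul_nonneg (hw0 t).le (hq0 t').le)]
        simp only [h1]
        rw [integral_const_mul, hq1, mul_one]
      rw [e]
      exact hwi
  have hsm : Measurable fun p : X × X => imhFlow w q p.1 p.2 := by
    unfold imhFlow
    exact ((hwm.comp measurable_fst).mul (hqm.comp measurable_snd)).min
      ((hwm.comp measurable_snd).mul (hqm.comp measurable_fst))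
  have hs_le : ∀ t t', |imhFlow w q t t'| ≤ w t * q t' := by
    intro t t'
    unfold imhFlow
    rw [abs_of_nonneg (le_min (mul_nonneg (hw0 t).le (hq0 t').le)
      (mul_nonneg (hw0 t').le (hq0 t).le))]
    exact min_le_left _ _
  have hF1 : Integrable (fun p : X × X => imhFlow w q p.1 p.2 * g p.2) (μ.prod μ) := by
    refine Integrable.mono' (hG.const_mul B)
      (hsm.mul (hgm.comp measurable_snd)).aestronglyMeasurable (Eventually.of_forall fun p => ?_)
    rw [Real.norm_eq_abs, abs_mul]
    calc |imhFlow w q p.1 p.2| * |g p.2| ≤ (w p.1 * q p.2) * B :=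
          mul_le_mul (hs_le _ _) (hgb _) (abs_nonneg _) (mul_nonneg (hw0 _).le (hq0 _).le)
      _ = B * (w p.1 * q p.2) := by ring
  have hF2 : Integrable (fun p : X × X => imhFlow w q p.1 p.2 * g p.1) (μ.prod μ) := by
    refine Integrable.mono' (hG.const_mul B)
      (hsm.mul (hgm.comp measurable_fst)).aestronglyMeasurable (Eventually.of_forall fun p => ?_)
    rw [Real.norm_eq_abs, abs_mul]
    calc |imhFlow w q p.1 p.2| * |g p.1| ≤ (w p.1 * q p.2) * B :=
          mul_le_mul (hs_le _ _) (hgb _) (abs_nonneg _) (mul_nonneg (hw0 _).le (hq0 _).le)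
      _ = B * (w p.1 * q p.2) := by ring
  -- pointwise in `t`
  have hline : ∀ t,
      (∫ t', (min 1 (w t' * q t / (w t * q t')) * g t'
        + (1 - min 1 (w t' * q t / (w t * q t'))) * g t) * q t' ∂μ) * w t
        = (∫ t', imhFlow w q t t' * g t' ∂μ) + g t * w t - ∫ t', imhFlow w q t t' * g t ∂μ := by
    intro t
    have ham : Measurable fun t' => min (1 : ℝ) (w t' * q t / (w t * q t')) :=
      measurable_const.min (((hwm.mul_const (q t))).div ((hqm.const_mul (w t))))
    have hI1 : Integrable (fun t' => min 1 (w t' * q t / (w t * q t')) * g t' * q t') μ := by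
      refine Integrable.mono' (hqi.const_mul B) ((ham.mul hgm).mul hqm).aestronglyMeasurable
        (Eventually.of_forall fun t' => ?_)
      rw [Real.norm_eq_abs, abs_mul, abs_mul, abs_of_nonneg (ha_nn t t'), abs_of_nonneg (hq0 _).le]
      calc min 1 (w t' * q t / (w t * q t')) * |g t'| * q t' ≤ 1 * B * q t' := by
            gcongr
            · exact (hq0 _).le
            · exact ha_le t t'
            · exact hgb t'
        _ = B * q t' := by ring
    have hI3 : Integrable (fun t' => min 1 (w t' * q t / (w t * q t')) * g t * q t') μ := by
      refine Integrable.mono' (hqi.const_mul B) ((ham.mul measurable_const).mul hqm).aestronglyMeasurable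
        (Eventually.of_forall fun t' => ?_)
      rw [Real.norm_eq_abs, abs_mul, abs_mul, abs_of_nonneg (ha_nn t t'), abs_of_nonneg (hq0 _).le]
      calc min 1 (w t' * q t / (w t * q t')) * |g t| * q t' ≤ 1 * B * q t' := by
            gcongr
            · exact (hq0 _).le
            · exact ha_le t t'
            · exact hgb t
        _ = B * q t' := by ring
    have hI2 : Integrable (fun t' => (1 - min 1 (w t' * q t / (w t * q t'))) * g t * q t') μ := by
      have e : (fun t' => (1 - min 1 (w t' * q t / (w t * q t'))) * g t * q t')
          = fun t' => g t * q t' - min 1 (w t' * q t / (w t * q t')) * g t * q t' := by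
        funext t'; ring
      rw [e]
      exact (hqi.const_mul (g t)).sub hI3
    have hsplit : ∀ t', (min 1 (w t' * q t / (w t * q t')) * g t'
        + (1 - min 1 (w t' * q t / (w t * q t'))) * g t) * q t'
        = min 1 (w t' * q t / (w t * q t')) * g t' * q t'
          + (1 - min 1 (w t' * q t / (w t * q t'))) * g t * q t' := fun t' => by ring
    simp only [hsplit]
    rw [integral_add hI1 hI2, add_mul]
    have e1 : (∫ t', min 1 (w t' * q t / (w t * q t')) * g t' * q t' ∂μ) * w t
        = ∫ t', imhFlow w q t t' * g t' ∂μ := by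
      rw [← integral_mul_const]
      refine integral_congr_ae (Eventually.of_forall fun t' => ?_)
      dsimp only
      rw [← imh_accept_mul_weight w q (hw0 t) (hq0 t')]
      ring
    have e2 : (∫ t', (1 - min 1 (w t' * q t / (w t * q t'))) * g t * q t' ∂μ) * w t
        = g t * w t - ∫ t', imhFlow w q t t' * g t ∂μ := by
      have hsplit2 : ∀ t', (1 - min 1 (w t' * q t / (w t * q t'))) * g t * q t'
          = g t * q t' - min 1 (w t' * q t / (w t * q t')) * g t * q t' := fun t' => by ring
      simp only [hsplit2]
      rw [integral_sub (hqi.const_mul (g t)) hI3, integral_const_mul, hq1, mul_one, sub_mul,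
        ← integral_mul_const]
      congr 1
      refine integral_congr_ae (Eventually.of_forall fun t' => ?_)
      dsimp only
      rw [← imh_accept_mul_weight w q (hw0 t) (hq0 t')]
      ring
    rw [e1, e2]
    ring
  simp only [hline]
  have hI1t : Integrable (fun t => ∫ t', imhFlow w q t t' * g t' ∂μ) μ := hF1.integral_prod_left
  have hI2t : Integrable (fun t => ∫ t', imhFlow w q t t' * g t ∂μ) μ := hF2.integral_prod_left
  have hgw : Integrable (fun t => g t * w t) μ := by
    refine Integrable.mono' (hwi.const_mul B) (hgm.mul hwm).aestronglyMeasurable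
      (Eventually.of_forall fun t => ?_)
    rw [Real.norm_eq_abs, abs_mul, abs_of_pos (hw0 t)]
    exact mul_le_mul_of_nonneg_right (hgb t) (hw0 t).le
  have hsum : Integrable (fun t => (∫ t', imhFlow w q t t' * g t' ∂μ) + g t * w t) μ := hI1t.add hgw
  rw [integral_sub hsum hI2t, integral_add hI1t hgw]
  have hswap : ∫ t, ∫ t', imhFlow w q t t' * g t' ∂μ ∂μ = ∫ t, ∫ t', imhFlow w q t t' * g t ∂μ ∂μ := by
    rw [integral_integral_swap hF1]
    refine integral_congr_ae (Eventually.of_forall fun t' => ?_)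
    refine integral_congr_ae (Eventually.of_forall fun t => ?_)
    dsimp only
    rw [imhFlow_symm w q t t']
  rw [hswap]
  ring

end General

/-! ## The lattice: the flow sampler for φ⁴ -/

section Lattice

variable {n : ℕ}

/-- The independence-Metropolis acceptance of row 2's flow sampler: target `p ∝ e^{−S}`
(`gibbsWeight J λ`), model density `q` (the flow's push-forward density), importance weights
`w = p/q`, accept `φ → φ'` with `min(1, w(φ')/w(φ)) = min(1, e^{−S(φ')} q(φ) / (e^{−S(φ)} q(φ')))`. -/
noncomputable def imhAcceptPhi4 (J : Fin (n + 1) → Fin (n + 1) → ℝ) (lam : ℝ)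
    (q : (Fin (n + 1) → ℝ) → ℝ) (φ φ' : Fin (n + 1) → ℝ) : ℝ :=
  min 1 (gibbsWeight J lam φ' * q φ / (gibbsWeight J lam φ * q φ'))

/-- The flow sampler's one-step operator on observables: propose `φ' ∼ q dφ'`, accept with
`imhAcceptPhi4`, else keep `φ`. -/
noncomputable def imhOpPhi4 (J : Fin (n + 1) → Fin (n + 1) → ℝ) (lam : ℝ)
    (q : (Fin (n + 1) → ℝ) → ℝ) (f : (Fin (n + 1) → ℝ) → ℝ) (φ : Fin (n + 1) → ℝ) : ℝ :=
  ∫ φ', (imhAcceptPhi4 J lam q φ φ' * f φ' + (1 - imhAcceptPhi4 J lam q φ φ') * f φ) * q φ'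

/-- **THE FLOW SAMPLER (INDEPENDENCE METROPOLIS) IS EXACT FOR LATTICE φ⁴ ON `ℝ^Λ`.**  Let the
action be coercive (every `λ > 0`, any real `J`; or the free field with `J + Jᵀ ≽ 2ε`) and let
the model have a positive measurable probability density `q` on `ℝ^Λ` (any normalizing flow with a
positive prior: real NVP / affine coupling layers).  Then for every bounded measurable `f`:
`∫ (K f) e^{−S} dφ = ∫ f e^{−S} dφ` — however badly the flow is trained. -/
theorem imh_exact {J : Fin (n + 1) → Fin (n + 1) → ℝ} {lam ε K : ℝ} (hε : 0 < ε)
    (hS : ∀ φ : Fin (n + 1) → ℝ, ε * ∑ w, φ w ^ 2 - K ≤ latticePhi4Action J lam φ)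
    {q : (Fin (n + 1) → ℝ) → ℝ} (hq0 : ∀ φ, 0 < q φ) (hqm : Measurable q) (hqi : Integrable q)
    (hq1 : ∫ φ, q φ = 1) {f : (Fin (n + 1) → ℝ) → ℝ} (hfm : Measurable f) {B : ℝ}
    (hfb : ∀ φ, |f φ| ≤ B) :
    ∫ φ, imhOpPhi4 J lam q f φ * gibbsWeight J lam φ = ∫ φ, f φ * gibbsWeight J lam φ := by
  unfold imhOpPhi4 imhAcceptPhi4
  exact imh_integral_invariant (μ := (volume : Measure (Fin (n + 1) → ℝ)))
    (fun φ => gibbsWeight_pos J lam φ) (continuous_gibbsWeight J lam).measurable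
    (integrable_gibbsWeight_of_coercive hε hS) hq0 hqm hqi hq1 hfm hfb

/-- **Normalised form**: `⟨K f⟩ = ⟨f⟩` in the Gibbs law. -/
theorem imh_exact_expect {J : Fin (n + 1) → Fin (n + 1) → ℝ} {lam ε K : ℝ} (hε : 0 < ε)
    (hS : ∀ φ : Fin (n + 1) → ℝ, ε * ∑ w, φ w ^ 2 - K ≤ latticePhi4Action J lam φ)
    {q : (Fin (n + 1) → ℝ) → ℝ} (hq0 : ∀ φ, 0 < q φ) (hqm : Measurable q) (hqi : Integrable q)
    (hq1 : ∫ φ, q φ = 1) {f : (Fin (n + 1) → ℝ) → ℝ} (hfm : Measurable f) {B : ℝ}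
    (hfb : ∀ φ, |f φ| ≤ B) :
    gibbsExpect J lam (imhOpPhi4 J lam q f) = gibbsExpect J lam f := by
  unfold gibbsExpect
  rw [imh_exact hε hS hq0 hqm hqi hq1 hfm hfb]

/-- **Every `λ > 0`, every real coupling matrix** (the AKS 2019 sets included): the flow sampler
with accept/reject is exact. -/
theorem imh_exact_phi4 {lam : ℝ} (hlam : 0 < lam) (J : Fin (n + 1) → Fin (n + 1) → ℝ)
    {q : (Fin (n + 1) → ℝ) → ℝ} (hq0 : ∀ φ, 0 < q φ) (hqm : Measurable q) (hqi : Integrable q)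
    (hq1 : ∫ φ, q φ = 1) {f : (Fin (n + 1) → ℝ) → ℝ} (hfm : Measurable f) {B : ℝ}
    (hfb : ∀ φ, |f φ| ≤ B) :
    gibbsExpect J lam (imhOpPhi4 J lam q f) = gibbsExpect J lam f :=
  imh_exact_expect one_pos (latticePhi4Action_coercive hlam J) hq0 hqm hqi hq1 hfm hfb

end Lattice

end Summit.Ventures.LatticeQCDFlow.Exactness
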